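/-
Copyright: the b2b-balaban T⁴-continuum CRUX team, row NE7b owner lineage `t4-ne7b-p1` (gen 116). Project licence.
-/
import Summits.QuantumFields.BalabanUV.T4Continuum.Spine.NE7b.OneShotChartWeightedGradientRows
import Summits.QuantumFields.BalabanUV.T4Continuum.Spine.NE7b.SupBackgroundLocalisation

/-!
# THE BLOCK-SCALE GRADIENT OF THE INTERACTING BACKGROUND IS LOCALISED: the weighted chart-gradient letter
# `e^{μρ(blk p)}|φ(p+e_μ) − φ(p)| ≤ (n+1)⁻¹·(C_H(μ)‖Q′φ‖_{μ,ρ} + C_Γ′(μ)‖P(Aφ)‖_{μ,ρ∘blk})` for EVERY bounded field on `ℤ^d`, `d ≥ 3`,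
# every side, one `A′`; hence for two solutions of (60)'s background system the GRADIENT of their difference at `p` is read off the
# coarse data within `D` blocks of `p` up to `e^{−μD}` — the background's η-gradient is an INTENSIVE functional of the coarse field
# (row NE7b, node U5c; ASE ∕ (62) ∕ (63) ∕ the owner's weighted gradient rows BY NAME; [folklore])

Cell `pub-balaban`, sub-cell `t4`, spine estimate NE7b (`T4WeightBudget.RelWeightBound`; the cell's OWN estimate — NOT PRINTED in
[Bałaban 1983–89], NOT PROVED).  Crux-route work under `Spine/NE7b/` by the row OWNER (`t4-ne7b-p1` gen 116) under FREEZE (0)'s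
crux-prover clause (FILING-CLAIM C-ne7bp1-g116-4); NOTHING of Bałaban's is named, valued or asserted; no `T4Continuum/Support` leaf
typed; no `def`, no notation; zero `sorry`.  Imports (BY NAME): the owner's `…OneShotChartWeightedGradientRows` (`weighted_augInverse_diff`;
through it (62) `weighted_blockAvg`, (58)-style `abs_apply_le_norm`) and (63) `…SupBackgroundLocalisation` (`abs_le_of_far`; through it ASE
`exists_aug_equiv_sup`).

WHY (located).  (75) `…SupBackgroundGradient` gave the PLAIN gradient letter of the sup chart and of the interacting background;
print's regions are LOCAL conditions ([B5] (1.65) `|∂H_k(x,y)| ≤ O(1)e^{−δ|x−y|}`; PRICING-NE7b F721 (iii) «volume-size vs intensive»):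
the background's gradient AT A SITE must be controlled by the coarse field NEAR that site.  With the weighted gradient rows of the free
chart in hand (`…OneShotChartWeightedGradientRows.weighted_augInverse_diff`), ASE's identity `φ = T⁻¹(Q′φ, P(Aφ)) = H(Q′φ) + Γ(P(Aφ))`
gives the weighted chart-gradient letter for EVERY bounded field (§1); for a PAIR of solutions `φ, ψ` of the sitewise background system
the `P∘A`-image difference is `Q′(u∘φ − u∘ψ)∘blk − (u∘φ − u∘ψ)`, weighted size `≤ 2λ‖φ − ψ‖_{μ,ρ∘blk}` (§2); and (63) §3 turns the
weighted letter — uniform over the bounded admissible weights — into the far-support statement (§2).  No new analysis.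

WHAT IS PROVED ([folklore]; `ℓ^∞ := lp (fun _ : X d => ℝ) ∞`; `C_H(μ) := cHs·K_d(δ_H − μ)`, `C_G(μ) := A_G·K_d(δ_u∕4 − μ)` written out;
`A′` = (50)'s gradient constant; `C_Γ′(μ) := A′K_d(δ_u∕4 − μ) + C_H(μ)C_G(μ)`):
* §1 **`exists_chart_gradient_weighted`** — `d ≥ 3`, `a > 0`: `∃ A′ ≥ 0, ∀ n, ∃ Q′ A P` (actions displayed) with, for every
  `0 ≤ μ < δ_H`, `μ < δ_u∕4`, admissible `ρ`, `φ ∈ ℓ^∞` and weighted bounds `R_v` of `Q′φ` (weight `ρ`), `R_κ` of `P(Aφ)` (weight `ρ∘blk`):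
  `e^{μρ(blk p)}|φ(p+e_μ) − φ(p)| ≤ (n+1)⁻¹·(C_H(μ)R_v + C_Γ′(μ)R_κ)`.
* §2 readers (generic in §1's two constants `C₁`, `C₂ ≥ 0`): `weighted_fibreProj_le` (`e^{μρ∘blk}|Pg| ≤ 2R_g`);
  **`weighted_diff_le_of_background_pair`** (`Aφ + u∘φ`, `Aψ + u∘ψ` block-constant, `|u s − u t| ≤ λ|s − t|`, weighted bounds `R_v` of
  `Q′(φ − ψ)`, `R` of `φ − ψ` ⟹ `e^{μρ(blk p)}|(φ−ψ)(p+e_μ) − (φ−ψ)(p)| ≤ (n+1)⁻¹·(C₁R_v + C₂·2λR)`);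
  **`far_gradient_of_background_pair`** (the letter for every bounded admissible `ρ` at rate `μ ≥ 0` + a weighted value letter
  `R ≤ K_σR_v` of (64) (a)'s shape + `Q′(φ − ψ) ≡ 0` on `{y : |y − blk p|_∞ < D}` ⟹
  `|(φ−ψ)(p+e_μ) − (φ−ψ)(p)| ≤ (n+1)⁻¹·(C₁ + 2λC₂K_σ)·‖Q′(φ−ψ)‖·e^{−μD}`) — THE GRADIENT OF THE INTERACTING BACKGROUND AT A SITE IS READ
  OFF THE COARSE FIELD WITHIN `D` BLOCKS, UP TO `e^{−μD}`.
* §3 toy.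

HONEST (what this is NOT).  Forward differences; constants ∕ rates existential and useless by value; the weighted value letter of the
background pair is CONSUMED in (64) (a)'s shape, not re-derived here; no second differences; scalar `ℤ^d` skeleton, sitewise interaction;
nothing of the covariant `H_k`, (A3) ∕ (A1c) (NC-NE7b-α UNRULED).  BY-NAME EFFECT ON THE WALL: NONE.  NE7b NOT PRINTED ∕ NOT PROVED; spine
PROVED 0∕9; rung (B)+1 on a FINITE torus — NOT infinite volume, NOT the mass gap, NOT Clay.  HONEST DEPENDENCY: continuum YM on T⁴ ⇐
BetaPertH ∧ nine spine estimates (0∕9 proved); BetaPertH ⇐ (D1) ∧ (D4) ∧ CAP+tail; G-an2-4 gates asym, D1 and NE2∕3∕4.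
-/

set_option autoImplicit false

noncomputable section

namespace Summit.QuantumFields.BalabanUV.T4Continuum.NE7b.SupBackgroundGradientLocalised

open scoped ENNReal NNReal
open Metric Set
open Literature.MathematicalPhysics.QuantumFieldTheory.Balaban1983to89
open B4Sect5Proof (latticeConst latticeConst_nonneg)
open B6QGQLower276 (X e blk B mem_B sum_B_const AX)
open B6QGQDecay237 (deltaU deltaU_pos)
open B5Hk103ScalarZd (Gk nbhd deltaH deltaH_pos)
open B5Hk165L2Zd (HBZd)
open Summit.QuantumFields.BalabanUV.Beta.D1BFx.BlockColumnSupNorm (cHs cHs_nonneg)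
open Summit.QuantumFields.BalabanUV.Beta.D1BFx.PointColumnSplit (cKL cG0 cSplit)
open Summit.QuantumFields.BalabanUV.Beta.D1BFx.PointColumnDecay (cFar)
open BlockPropagatorSupGradient (exists_sum_block_abs_Gk_diff_le)
open LocalNemytskiiSup (abs_apply_le_norm)
open OneShotChartWeightedRows (weighted_blockAvg)
open OneShotChartWeightedGradientRows (weighted_augInverse_diff)
open AugmentedSupEquivalence (exists_aug_equiv_sup)
open SupBackgroundLocalisation (abs_le_of_far)

variable {d : ℕ}

/-! ## §1. Operator level: the weighted chart-gradient letter for every bounded field -/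

/-- **THE WEIGHTED CHART-GRADIENT LETTER** (`d ≥ 3`, `a > 0`): there is ONE `A′ ≥ 0` such that for EVERY side the skeleton's
operators `Q′, A, P` (actions displayed) satisfy: for every `0 ≤ μ < δ_H`, `μ < δ_u∕4`, every weight with
`ρ x − ρ y ≤ |x − y|_∞`, every `φ ∈ ℓ^∞(ℤ^d)` and weighted bounds `e^{μρ(y)}|Q′φ(y)| ≤ R_v`, `e^{μρ(blk q)}|P(Aφ)(q)| ≤ R_κ`:
`e^{μρ(blk p)}|φ(p+e_μ) − φ(p)| ≤ (n+1)⁻¹·(C_H(μ)R_v + (A′K_d(δ_u∕4 − μ) + C_H(μ)C_G(μ))R_κ)` — because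
`φ = T⁻¹(Q′φ, P(Aφ)) = H(Q′φ) + Γ(P(Aφ))` (ASE) and the weighted gradient rows of `T⁻¹`. [folklore] -/
theorem exists_chart_gradient_weighted (hd : 3 ≤ d) {a : ℝ} (ha : 0 < a) :
    ∃ A' : ℝ, 0 ≤ A' ∧ ∀ n : ℕ,
      ∃ (Dop Aop Pop : lp (fun _ : X d => ℝ) ∞ →L[ℝ] lp (fun _ : X d => ℝ) ∞),
        (∀ (f : lp (fun _ : X d => ℝ) ∞) (y : X d), Dop f y = (((n : ℝ) + 1) ^ d)⁻¹ * ∑ p ∈ B n y, f p) ∧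
        (∀ (f : lp (fun _ : X d => ℝ) ∞) (p : X d), Aop f p = ∑ r ∈ nbhd n p, AX n a p r * f r) ∧
        (∀ (f : lp (fun _ : X d => ℝ) ∞) (p : X d),
          Pop f p = f p - (((n : ℝ) + 1) ^ d)⁻¹ * ∑ p' ∈ B n (blk n p), f p') ∧
        ∀ {μ : ℝ}, 0 ≤ μ → μ < deltaH d a → μ < deltaU d a / 4 →
          ∀ {ρ : X d → ℝ}, (∀ x y, ρ x - ρ y ≤ dist x y) →
            ∀ (φ : lp (fun _ : X d => ℝ) ∞) {Rv Rκ : ℝ},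
              (∀ y, Real.exp (μ * ρ y) * |Dop φ y| ≤ Rv) →
              (∀ q, Real.exp (μ * ρ (blk n q)) * |Pop (Aop φ) q| ≤ Rκ) →
                ∀ (p : X d) (ν : Fin d), Real.exp (μ * ρ (blk n p)) * |φ (p + e ν) - φ p|
                  ≤ ((n : ℝ) + 1)⁻¹ * (cHs d a * latticeConst d (deltaH d a - μ) * Rv
                      + (A' * latticeConst d (deltaU d a / 4 - μ) + cHs d a * latticeConst d (deltaH d a - μ)
                          * (((cG0 d * cKL d (d - 2) + cSplit d a) * Real.exp (2 * deltaU d a)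
                              + cFar d a * Real.exp (4 * deltaU d a) / deltaU d a ^ 2)
                            * latticeConst d (deltaU d a / 4 - μ))) * Rκ) := by
  obtain ⟨A', hA0, hA'⟩ := exists_sum_block_abs_Gk_diff_le hd ha
  refine ⟨A', hA0, fun n => ?_⟩
  obtain ⟨Dop, Aop, Pop, hD, hA, hP, -, -, Rop, hR, T, hT, hsymm, -⟩ := exists_aug_equiv_sup hd n ha
  refine ⟨Dop, Aop, Pop, hD, hA, hP, fun hμ0 hμH hμU ρ hρ φ Rv Rκ hv hκ p ν => ?_⟩
  have hφ : T.symm (Dop φ, Rop φ) = φ := by rw [← hT φ, ContinuousLinearEquiv.symm_apply_apply]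
  have hpt : ∀ q : X d, φ q
      = HBZd n a (Dop φ) q + ((∑' q' : X d, Gk n a q q' * (Pop (Aop φ)) q')
          - HBZd n a (fun y => (((n : ℝ) + 1) ^ d)⁻¹ * ∑ p' ∈ B n y,
              ∑' q' : X d, Gk n a p' q' * (Pop (Aop φ)) q') q) := fun q => by
    have h1 : φ q = (T.symm (Dop φ, Rop φ) : lp (fun _ : X d => ℝ) ∞) q := by rw [hφ]
    rw [h1, hsymm, hR]
  rw [hpt (p + e ν), hpt p]
  exact weighted_augInverse_diff hd n ha hμ0 hμH hμU hA0 (hA' n) hρ (abs_apply_le_norm (Dop φ)) hv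
    (abs_apply_le_norm (Pop (Aop φ))) hκ p ν

/-! ## §2. Readers: the fibre projection in the weighted currency; pairs of solutions of the background system; far support -/

section Readers

variable {n : ℕ} {C₁ C₂ : ℝ} {μ : ℝ} {ρ : X d → ℝ}
  {Dop Aop Pop : lp (fun _ : X d => ℝ) ∞ →L[ℝ] lp (fun _ : X d => ℝ) ∞}

/-- **The fibre projection costs a factor `2` in the weighted currency**: `e^{μρ(blk q)}|g(q) − Q′g(blk q)| ≤ 2R_g` whenever
`e^{μρ(blk q)}|g(q)| ≤ R_g` ((62) §4: block averaging is weight-neutral). [folklore] -/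
theorem weighted_fibreProj_le (n : ℕ) {μ : ℝ} {ρ : X d → ℝ} {g : X d → ℝ} {Rg : ℝ}
    (hg : ∀ q, Real.exp (μ * ρ (blk n q)) * |g q| ≤ Rg) (q : X d) :
    Real.exp (μ * ρ (blk n q)) * |g q - (((n : ℝ) + 1) ^ d)⁻¹ * ∑ p' ∈ B n (blk n q), g p'| ≤ 2 * Rg := by
  have h1 := hg q
  have h2 := weighted_blockAvg n hg (blk n q)
  have hE : 0 ≤ Real.exp (μ * ρ (blk n q)) := (Real.exp_pos _).le
  calc _ ≤ Real.exp (μ * ρ (blk n q)) * (|g q| + |(((n : ℝ) + 1) ^ d)⁻¹ * ∑ p' ∈ B n (blk n q), g p'|) :=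
        mul_le_mul_of_nonneg_left (abs_sub _ _) hE
    _ ≤ Rg + Rg := by rw [mul_add]; exact add_le_add h1 h2
    _ = 2 * Rg := by ring

/-- **THE WEIGHTED GRADIENT LETTER FOR A PAIR OF SOLUTIONS OF THE BACKGROUND SYSTEM** (generic in §1's letter at `(n, μ, ρ)` with
constants `C₁`, `C₂ ≥ 0`): if `Aφ + u∘φ` and `Aψ + u∘ψ` are block-constant (sitewise, (60)'s display), `|u s − u t| ≤ λ|s − t|`,
and `e^{μρ(y)}|Q′(φ − ψ)(y)| ≤ R_v`, `e^{μρ(blk q)}|(φ − ψ)(q)| ≤ R`, then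
`e^{μρ(blk p)}|(φ − ψ)(p+e_μ) − (φ − ψ)(p)| ≤ (n+1)⁻¹·(C₁R_v + C₂·2λR)` — the pair's `P∘A`-image difference is
`Q′(u∘φ − u∘ψ)∘blk − (u∘φ − u∘ψ)`, weighted size `≤ 2λR`. [folklore] -/
theorem weighted_diff_le_of_background_pair (hC₂ : 0 ≤ C₂)
    (hP : ∀ (f : lp (fun _ : X d => ℝ) ∞) (p : X d), Pop f p = f p - (((n : ℝ) + 1) ^ d)⁻¹ * ∑ p' ∈ B n (blk n p), f p')
    (hgrad : ∀ (φ : lp (fun _ : X d => ℝ) ∞) {Rv Rκ : ℝ},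
      (∀ y, Real.exp (μ * ρ y) * |Dop φ y| ≤ Rv) → (∀ q, Real.exp (μ * ρ (blk n q)) * |Pop (Aop φ) q| ≤ Rκ) →
        ∀ (p : X d) (ν : Fin d), Real.exp (μ * ρ (blk n p)) * |φ (p + e ν) - φ p| ≤ ((n : ℝ) + 1)⁻¹ * (C₁ * Rv + C₂ * Rκ))
    {u : ℝ → ℝ} {lam : ℝ} (hlam : 0 ≤ lam) (hu : ∀ s t, |u s - u t| ≤ lam * |s - t|)
    {φ ψ : lp (fun _ : X d => ℝ) ∞}
    (hφ : ∀ p : X d, Aop φ p + u (φ p) = (((n : ℝ) + 1) ^ d)⁻¹ * ∑ p' ∈ B n (blk n p), (Aop φ p' + u (φ p')))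
    (hψ : ∀ p : X d, Aop ψ p + u (ψ p) = (((n : ℝ) + 1) ^ d)⁻¹ * ∑ p' ∈ B n (blk n p), (Aop ψ p' + u (ψ p')))
    {Rv R : ℝ} (hv : ∀ y, Real.exp (μ * ρ y) * |Dop (φ - ψ) y| ≤ Rv)
    (hR : ∀ q, Real.exp (μ * ρ (blk n q)) * |(φ - ψ) q| ≤ R) (p : X d) (ν : Fin d) :
    Real.exp (μ * ρ (blk n p)) * |(φ - ψ) (p + e ν) - (φ - ψ) p| ≤ ((n : ℝ) + 1)⁻¹ * (C₁ * Rv + C₂ * (2 * lam * R)) := by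
  -- the sitewise term's difference has weighted size `≤ λR`
  have hg : ∀ q, Real.exp (μ * ρ (blk n q)) * |u (φ q) - u (ψ q)| ≤ lam * R := fun q => by
    have h1 := hu (φ q) (ψ q)
    have h2 := hR q
    rw [lp.coeFn_sub, Pi.sub_apply] at h2
    have hE : 0 ≤ Real.exp (μ * ρ (blk n q)) := (Real.exp_pos _).le
    calc _ ≤ Real.exp (μ * ρ (blk n q)) * (lam * |φ q - ψ q|) := mul_le_mul_of_nonneg_left h1 hE
      _ = lam * (Real.exp (μ * ρ (blk n q)) * |φ q - ψ q|) := by ring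
      _ ≤ lam * R := mul_le_mul_of_nonneg_left h2 hlam
  -- `P(A(φ − ψ))(q) = Q′(u∘φ − u∘ψ)(blk q) − (u(φ q) − u(ψ q))`
  have hPA : ∀ q, Pop (Aop (φ - ψ)) q
      = -((u (φ q) - u (ψ q)) - (((n : ℝ) + 1) ^ d)⁻¹ * ∑ p' ∈ B n (blk n q), (u (φ p') - u (ψ p'))) := fun q => by
    rw [hP, map_sub]
    simp only [lp.coeFn_sub, Pi.sub_apply, Finset.sum_sub_distrib, mul_sub]
    have h1 := hφ q
    have h2 := hψ q
    rw [Finset.sum_add_distrib, mul_add] at h1 h2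
    linarith
  have hκ : ∀ q, Real.exp (μ * ρ (blk n q)) * |Pop (Aop (φ - ψ)) q| ≤ 2 * (lam * R) := fun q => by
    rw [hPA, abs_neg]; exact weighted_fibreProj_le n hg q
  have hM : (0 : ℝ) ≤ ((n : ℝ) + 1)⁻¹ := by positivity
  refine (hgrad (φ - ψ) hv hκ p ν).trans (mul_le_mul_of_nonneg_left (add_le_add le_rfl ?_) hM)
  exact (mul_le_mul_of_nonneg_left (le_of_eq (by ring)) hC₂)

/-- **FAR SUPPORT: THE GRADIENT OF THE INTERACTING BACKGROUND AT A SITE IS READ OFF THE COARSE FIELD WITHIN `D` BLOCKS, UP TO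
`e^{−μD}`** (generic: §1's letter with constants `C₁, C₂ ≥ 0` for EVERY bounded admissible weight at rate `μ ≥ 0`, plus a weighted
value letter `‖φ − ψ‖_{μ,ρ∘blk} ≤ K_σ‖Q′(φ − ψ)‖_{μ,ρ}` of (64) (a)'s shape for the same weights): for two solutions `φ, ψ` of the sitewise
background system (`|u s − u t| ≤ λ|s − t|`) whose coarse data agree within `D` blocks of `blk p` (`Q′(φ − ψ)(y) = 0` for
`|y − blk p|_∞ < D`): `|(φ − ψ)(p+e_μ) − (φ − ψ)(p)| ≤ (n+1)⁻¹·(C₁ + C₂·2λK_σ)·‖Q′(φ − ψ)‖·e^{−μD}`. [folklore] -/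
theorem far_gradient_of_background_pair {μ : ℝ} (hμ0 : 0 ≤ μ) {C₁ C₂ Kσ : ℝ} (hC₁ : 0 ≤ C₁) (hC₂ : 0 ≤ C₂) (hKσ : 0 ≤ Kσ)
    (hP : ∀ (f : lp (fun _ : X d => ℝ) ∞) (p : X d), Pop f p = f p - (((n : ℝ) + 1) ^ d)⁻¹ * ∑ p' ∈ B n (blk n p), f p')
    (hgrad : ∀ ρ : X d → ℝ, (∀ x y, ρ x - ρ y ≤ dist x y) → (∃ M, ∀ y, |ρ y| ≤ M) →
      ∀ (φ : lp (fun _ : X d => ℝ) ∞) {Rv Rκ : ℝ},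
        (∀ y, Real.exp (μ * ρ y) * |Dop φ y| ≤ Rv) → (∀ q, Real.exp (μ * ρ (blk n q)) * |Pop (Aop φ) q| ≤ Rκ) →
          ∀ (p : X d) (ν : Fin d), Real.exp (μ * ρ (blk n p)) * |φ (p + e ν) - φ p| ≤ ((n : ℝ) + 1)⁻¹ * (C₁ * Rv + C₂ * Rκ))
    {u : ℝ → ℝ} {lam : ℝ} (hlam : 0 ≤ lam) (hu : ∀ s t, |u s - u t| ≤ lam * |s - t|)
    {φ ψ : lp (fun _ : X d => ℝ) ∞}
    (hφ : ∀ p : X d, Aop φ p + u (φ p) = (((n : ℝ) + 1) ^ d)⁻¹ * ∑ p' ∈ B n (blk n p), (Aop φ p' + u (φ p')))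
    (hψ : ∀ p : X d, Aop ψ p + u (ψ p) = (((n : ℝ) + 1) ^ d)⁻¹ * ∑ p' ∈ B n (blk n p), (Aop ψ p' + u (ψ p')))
    (hσ : ∀ ρ : X d → ℝ, (∀ x y, ρ x - ρ y ≤ dist x y) → (∃ M, ∀ y, |ρ y| ≤ M) →
      ∀ Rv : ℝ, (∀ y, Real.exp (μ * ρ y) * |Dop (φ - ψ) y| ≤ Rv) →
        ∀ q, Real.exp (μ * ρ (blk n q)) * |(φ - ψ) q| ≤ Kσ * Rv)
    (p : X d) (ν : Fin d) {D : ℝ} (hfar : ∀ y, dist y (blk n p) < D → Dop (φ - ψ) y = 0) :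
    |(φ - ψ) (p + e ν) - (φ - ψ) p| ≤ ((n : ℝ) + 1)⁻¹ * (C₁ + C₂ * (2 * lam * Kσ)) * ‖Dop (φ - ψ)‖ * Real.exp (-(μ * D)) := by
  have hK : 0 ≤ ((n : ℝ) + 1)⁻¹ * (C₁ + C₂ * (2 * lam * Kσ)) := by positivity
  have h := abs_le_of_far n hμ0 (K := ((n : ℝ) + 1)⁻¹ * (C₁ + C₂ * (2 * lam * Kσ))) (Cv := 1) (Cκ := 0) hK zero_le_one
    le_rfl (v := fun y => Dop (φ - ψ) y) (κ₀ := fun _ => 0) (Rv := ‖Dop (φ - ψ)‖) (Rκ := 0) (D := D)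
    (t := (φ - ψ) (p + e ν) - (φ - ψ) p) (fun y => abs_apply_le_norm _ y) (fun _ => by rw [abs_zero]) p hfar
    (fun _ _ => rfl) (fun ρ hρ hρb Rv' Rκ' hv _ => by
      rw [one_mul, zero_mul, add_zero]
      have h1 := weighted_diff_le_of_background_pair hC₂ hP (fun φ' Rv Rκ hv' hκ' => hgrad ρ hρ hρb φ' hv' hκ')
        hlam hu hφ hψ hv (hσ ρ hρ hρb Rv' hv) p ν
      refine h1.trans (le_of_eq ?_)
      ring)
  rwa [one_mul, zero_mul, add_zero] at h

end Readers

/-! ## §3. Toy -/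

/-- Toy: the shape of §2's constant — `C₁ = 2`, `C₂ = 3`, `2λK_σ = 1∕2`, side `4`: `(2 + 3·(1∕2))∕4 = 7∕8` per unit of
`‖Q′(φ − ψ)‖·e^{−μD}`. -/
example : (4 : ℝ)⁻¹ * (2 + 3 * (1 / 2)) = 7 / 8 := by norm_num

end Summit.QuantumFields.BalabanUV.T4Continuum.NE7b.SupBackgroundGradientLocalised

end
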